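import Literature.NumberTheory.GaloisCohomology.Howard2004.DVRSettingEngineData
import Literature.NumberTheory.GaloisCohomology.Howard2004.DVRSettingPiRefinementRings
import Literature.NumberTheory.GaloisCohomology.Howard2004.LevelQuotientProofs
import Literature.NumberTheory.GaloisCohomology.Howard2004.FrobIdealProofs
import HarnessLib

/-!
# Howard 2004, Lemma 1.6.4 on a `DVRSetting`: the prime sets `𝓛^{(2k-1)}`, the vanishing of `I_n` on the
# levels, and the stubs `Stub^{(k)}(n) = 𝔪^{λ^{(k)}(n)} H¹_{F(n)}(K, T^{(k)})` from a levelwise decomposition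
# (definitions with bodies + theorems; L164-DATA part 3)

B. Howard, *The Heegner point Kolyvagin system*, Compositio Math. **140** (2004) (arXiv:1202.6340): §1.6 (p. 11
L36–38: «`𝓛^{(k)} = 𝓛 ∩ 𝓛_k(T)` … `𝓝^{(k)}`»), Def. 1.5.4 (p. 10 L56–60: «`λ(n) = length(M(n))`,
`Stub(n) = 𝔪^{λ(n)} H¹_{F(n)}(K,T)`»), Thm. 1.4.2 (the decomposition `H¹_{F(n)}(K,T) ≅ R^ε ⊕ M(n) ⊕ M(n)`),
Lemma 1.6.4 (p. 11 L82–84: `n ∈ 𝓝^{(2k-1)}`).  Third part of the data layer of the ENGINE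
(`StubLemmaInductionProofs`; parts 1–2 = `DVRSettingEngineData`, `DVRSettingEngineKappa`):

* §1 **`DVRSetting.enginePrimes S k = 𝓛 ∩ 𝓛_{2e_k-1}(T)`** (the engine's `P k`), `enginePrimes_antitone` (`hP`),
  `mem_levelSet_of_subset_enginePrimes`, and **`ker_π_eq_bot_of_subset_enginePrimes`**: for `n ∈ 𝓝(P k)` the
  ideal `I_n` of the level ring kills `T^{(k)}` (`p^{2e_k-1} ∈ 𝔪^{e_k}`), so `π_n : T^{(k)} → T^{(k)}/I_n` has
  trivial kernel — the hypothesis `hker` of `kappaR` and of PRES;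
* §2 the levelwise structure as a HYPOTHESIS in the cell's package currency (`HasLevelDecompositions`: at every
  level `k` and `n ∈ 𝓝(P k)` an additive `R`-equivariant `θ : H¹_{F(n)}(K,T^{(k)}) ≃ (Fin ε → R/𝔪^{e_k}) × (M × M)`,
  `ε ≤ 1`, `M` finite — Howard's Thm. 1.4.2 for `(T^{(k)}, F(n))`, the ONE typed input of the cell's G87 board),
  and from a chosen decomposition **`stubLength`** (`λ^{(k)}(n) = len_R M`) and **`stub`** (`𝔪^{λ} · H`, as an
  `R`-submodule of the engine's `H k n = selmerModuleAt`), `mem_stub_iff`;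
* §3 (append) Howard's own key `𝓝^{(j)} = 𝓝(𝓛 ∩ 𝓛_{e_j})` (`levelPrimes`, `HasLevelDecompositionsAt`, the key under which
  the liftability case reads the decomposition at the level `j` with `e_j = 2e_k - 1`; x10b-p1-w7 g9's «DEC-KEY»).

Definitions with bodies and theorems: no named fact, no instance, no notation, no `sorry`.  The eigen-lengths
`ρ(n)^±` and the reductions `red` are NOT here.  `thm161_dvrKolyvaginBound` is NOT proved; BSD is not proved by any
of this.
-/

set_option autoImplicit false

noncomputable section

open Function NumberField IsDedekindDomain Field
open scoped NumberField ContRepresentation Classical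

namespace Literature.NumberTheory.GaloisCohomology.Howard2004

open Literature.NumberTheory.GaloisRepresentations
open Literature.NumberTheory.GaloisRepresentations.DiscreteGaloisModule

namespace DVRSetting

variable {p : ℕ} [Fact p.Prime] {K : Type} [Field K] [NumberField K]
  {R : Type} [CommRing R] [IsDomain R] [IsDiscreteValuationRing R] [Algebra ℤ_[p] R]
  {N : ℕ → Type} [∀ k, AddCommGroup (N k)] [∀ k, TopologicalSpace (N k)]
  [∀ k, DiscreteTopology (N k)] [∀ k, Module R (N k)]
  {Rk : ℕ → Type} [∀ k, CommRing (Rk k)] [∀ k, IsLocalRing (Rk k)] [∀ k, TopologicalSpace (Rk k)]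
  [∀ k, DiscreteTopology (Rk k)] [∀ k, Algebra ℤ_[p] (Rk k)] [∀ k, Algebra R (Rk k)]
  [∀ k, Module (Rk k) (N k)] [∀ k, IsScalarTower R (Rk k) (N k)]
  {Nbar : Type} [AddCommGroup Nbar] [TopologicalSpace Nbar] [DiscreteTopology Nbar]
  [∀ k, Module (Rk k) Nbar]
  {Nq : ℕ → Finset (HeightOneSpectrum (𝓞 K)) → Type} [∀ k n, AddCommGroup (Nq k n)]
  [∀ k n, TopologicalSpace (Nq k n)] [∀ k n, DiscreteTopology (Nq k n)]
  [∀ k n, Module (Rk k) (Nq k n)] [∀ k n, Module R (Nq k n)]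
  [∀ k n, IsScalarTower R (Rk k) (Nq k n)]

/-! ## §1 The prime sets `𝓛^{(2k-1)}` and the vanishing of `I_n` on `T^{(k)}` -/

/-- **`P k = 𝓛^{(2k-1)} = 𝓛 ∩ 𝓛_{2e_k-1}(T)`** — the primes used at level `k` in Lemma 1.6.4 (tree
`AdicTower.kolyvaginPrimes`: degree two, `p^s ∣ ℓ+1`, `Frob_λ ≡ 1 (mod p^s)` on every level, `s = 2e_k - 1`).
[cite: Howard2004HeegnerKolyvagin, §1.6 and Lemma 1.6.4 (arXiv p. 11 L36–38, L82–84)] -/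
def enginePrimes (S : DVRSetting p K R N Rk Nbar Nq) (k : ℕ) : Set (HeightOneSpectrum (𝓞 K)) :=
  {v | v ∈ S.L ∧ v ∈ S.T.kolyvaginPrimes p (2 * S.e k - 1)}

/-- `P k ⊆ 𝓛`. [cite: Howard2004HeegnerKolyvagin, §1.6 (arXiv p. 11, L36–38)] -/
theorem enginePrimes_subset_L (S : DVRSetting p K R N Rk Nbar Nq) (k : ℕ) : S.enginePrimes k ⊆ S.L :=
  fun _ hv => hv.1

/-- **`hP`: the prime sets decrease with the level** (`𝓛_s` is antitone in `s`, `e` is monotone).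
[cite: Howard2004HeegnerKolyvagin, §1.6 (arXiv p. 11, L36–38)] -/
theorem enginePrimes_antitone (S : DVRSetting p K R N Rk Nbar Nq) (hy : S.SatisfiesH) {i k : ℕ} (h : i ≤ k) :
    S.enginePrimes k ⊆ S.enginePrimes i := fun _ hv =>
  ⟨hv.1, S.T.kolyvaginPrimes_antitone p (by have := hy.e_strictMono.monotone h; omega) hv.2⟩

/-- `n ∈ 𝓝(P k) ⇒ n ∈ 𝓝(𝓛)` (the level set of every level triple, `primes_eq`).
[cite: Howard2004HeegnerKolyvagin, §1.2 (arXiv p. 6, L98–100)] -/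
theorem mem_levelSet_of_subset_enginePrimes (S : DVRSetting p K R N Rk Nbar Nq) (hy : S.SatisfiesH) (k j : ℕ)
    {n : Finset (HeightOneSpectrum (𝓞 K))} (hn : ↑n ⊆ S.enginePrimes k) : n ∈ (S.t j).levelSet := by
  change ↑n ⊆ (S.t j).primes
  rw [hy.primes_eq]
  exact fun v hv => (hn hv).1

/-- `p^s = 0` in `R_k` as soon as `e_k ≤ s` (`p ∈ 𝔪`). [cite: Howard2004HeegnerKolyvagin, §1.6 (arXiv p. 11, L33–38)] -/
theorem natCast_p_pow_eq_zero_levelRing (S : DVRSetting p K R N Rk Nbar Nq) (hy : S.SatisfiesH) {k s : ℕ}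
    (hs : S.e k ≤ s) : ((p : ℕ) : Rk k) ^ s = 0 := by
  rw [← map_natCast (algebraMap R (Rk k)), ← map_pow, ← RingHom.mem_ker, hy.ker_algebraMap]
  exact Ideal.pow_le_pow_right hs (Ideal.pow_mem_pow (S.natCast_p_mem_maximalIdeal hy) _)

/-- **For `λ ∈ 𝓛_s(T)` with `e_k ≤ s`, `I_λ(T^{(k)}) = 0` in the level ring `R_k`**: `ℓ + 1 ∈ p^sR_k = 0` and
`Frob_λ ≡ 1 (mod p^s T^{(k)} = 0)`. [cite: Howard2004HeegnerKolyvagin, Def. 1.2.1 and §1.6 (arXiv p. 6 L63–68, p. 11 L36–38)] -/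
theorem frobIdeal_eq_bot_of_mem_kolyvaginPrimes (S : DVRSetting p K R N Rk Nbar Nq) (hy : S.SatisfiesH) {k s : ℕ}
    (hs : S.e k ≤ s) {v : HeightOneSpectrum (𝓞 K)} (hv : v ∈ S.T.kolyvaginPrimes p s) :
    frobIdeal (R := Rk k) (S.T.ρ k) v = ⊥ := by
  have h0 : ((p : ℕ) : Rk k) ^ s = 0 := S.natCast_p_pow_eq_zero_levelRing hy hs
  refine le_bot_iff.mp (frobIdeal_le_of_mem (S.T.ρ k) v ⟨?_, fun σ hσ m => ?_⟩)
  · -- `ℓ + 1 ∈ p^s R`, read in `R_k`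
    obtain ⟨a, ha⟩ := Ideal.mem_span_singleton'.mp hv.2.1
    have : ((residueChar v + 1 : ℕ) : Rk k) = algebraMap R (Rk k) a * ((p : ℕ) : Rk k) ^ s := by
      rw [← map_natCast (algebraMap R (Rk k)) (residueChar v + 1), ← ha, map_mul, map_pow, map_natCast]
    rw [this, h0, mul_zero]
    exact Submodule.zero_mem _
  · have hm := hv.2.2 k σ hσ m
    rw [Submodule.ideal_span_singleton_smul, Submodule.mem_smul_pointwise_iff_exists] at hm
    obtain ⟨y, -, hy'⟩ := hm
    rw [← hy']
    have hz : ((p : ℕ) : R) ^ s • y = 0 := by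
      rw [← algebraMap_smul (Rk k), map_pow, map_natCast, h0, zero_smul]
    rw [hz]
    exact Submodule.zero_mem _

/-- **`hker`: for `n ∈ 𝓝(𝓛^{(2k-1)})` the presentation `π_n : T^{(k)} ↠ T^{(k)}/I_n T^{(k)}` has trivial
kernel** (`I_n(T^{(k)}) = Σ I_λ = 0` in `R_k`, as `2e_k - 1 ≥ e_k`). [cite: Howard2004HeegnerKolyvagin, §1.6 and Lemma 1.6.4 (arXiv p. 11 L36–38: «T^{(k)}/I_n = T^{(k)} for n ∈ 𝓝^{(k)}»)] -/
theorem ker_π_eq_bot_of_subset_enginePrimes (S : DVRSetting p K R N Rk Nbar Nq) (hy : S.SatisfiesH) (k : ℕ)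
    {n : Finset (HeightOneSpectrum (𝓞 K))} (hn : ↑n ⊆ S.enginePrimes k) :
    LinearMap.ker ((S.LD k).π n) = ⊥ := by
  rw [((S.LD k).isQuotientBy n).ker_eq]
  have hI : levelIdeal (R := Rk k) (S.T.ρ k) n = ⊥ := by
    rw [levelIdeal, eq_bot_iff]
    refine iSup₂_le fun v hv => ?_
    have h1 : 0 < S.e k := hy.e_zero.trans_le (hy.e_strictMono.monotone (Nat.zero_le k))
    rw [S.frobIdeal_eq_bot_of_mem_kolyvaginPrimes hy (by omega) (hn hv).2]
  rw [hI, Submodule.bot_smul]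

/-! ## §2 The stubs from a levelwise decomposition -/

/-- **The levelwise structure Thm. 1.4.2 as a hypothesis** (the cell's package currency, cf.
`DVRKolyvaginBoundLevelwisePackageProofs.conclusion_of_exists_levelwise_package`): at every level `k` and every
`n ∈ 𝓝(𝓛^{(2k-1)})` an additive `R`-equivariant bijection `H¹_{F(n)}(K, T^{(k)}) ≃ (Fin ε → R/𝔪^{e_k}) × (M × M)` with
`ε ≤ 1` and `M` finite. [cite: Howard2004HeegnerKolyvagin, Thm. 1.4.2 applied to (T^{(k)}, F(n)) (arXiv Thm. 2.4.2, p. 8 L99–105; §1.6 p. 11 L38–44)] -/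
def HasLevelDecompositions (S : DVRSetting p K R N Rk Nbar Nq) (hy : S.SatisfiesH) : Prop :=
  ∀ (k : ℕ) (n : Finset (HeightOneSpectrum (𝓞 K))), ↑n ⊆ S.enginePrimes k →
    ∃ (ε : ℕ) (_ : ε ≤ 1) (M : Type) (_ : AddCommGroup M) (_ : Module R M) (_ : Finite M)
      (θ : ↥((((S.t k).atLevel S.jbar n).cond).selmerGroup) ≃+
        ((Fin ε → R ⧸ IsLocalRing.maximalIdeal R ^ S.e k) × (M × M))),
      ∀ (r : R) (y : galoisCohomology (S.T.ρ k) 1) (hy' : y ∈ (((S.t k).atLevel S.jbar n).cond).selmerGroup),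
        θ ⟨galoisCohomology.scalarMapH1 (S.T.ρ k) (S.T.hlin k) r y,
            S.scalarMapH1_mem_selmerGroup_atLevel hy k n r hy'⟩ = r • θ ⟨y, hy'⟩

/-- **`λ^{(k)}(n) = len_R M^{(k)}(n)`** for the CHOSEN decomposition at `(k, n)` (`0` off `𝓝(𝓛^{(2k-1)})`; independent of
the choice by `epsilon_eq_and_length_eq_of_two_decompositions`). [cite: Howard2004HeegnerKolyvagin, Def. 1.5.4 (arXiv Def. 2.5.4, p. 10 L56–58)] -/
def stubLength (S : DVRSetting p K R N Rk Nbar Nq) (hy : S.SatisfiesH) (hdec : S.HasLevelDecompositions hy) (k : ℕ)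
    (n : Finset (HeightOneSpectrum (𝓞 K))) : ℕ :=
  if hn : ↑n ⊆ S.enginePrimes k then
    @Module.length R (Classical.choose (Classical.choose_spec (Classical.choose_spec (hdec k n hn))))
      _ (Classical.choose (Classical.choose_spec (Classical.choose_spec (Classical.choose_spec (hdec k n hn)))))
      (Classical.choose (Classical.choose_spec (Classical.choose_spec (Classical.choose_spec
        (Classical.choose_spec (hdec k n hn)))))) |>.toNat
  else 0

/-- **`Stub^{(k)}(n) = 𝔪^{λ^{(k)}(n)} · H¹_{F(n)}(K, T^{(k)})`** as an `R`-submodule of the engine's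
`H k n = selmerModuleAt` (`𝔪 = (π)`). [cite: Howard2004HeegnerKolyvagin, Def. 1.5.4 (arXiv Def. 2.5.4, p. 10 L58–60)] -/
def stub (S : DVRSetting p K R N Rk Nbar Nq) (hy : S.SatisfiesH) (hdec : S.HasLevelDecompositions hy) (k : ℕ)
    (n : Finset (HeightOneSpectrum (𝓞 K))) :
    letI := galoisCohomology.moduleH1 (S.T.ρ k) (S.T.hlin k)
    Submodule R ↥(S.selmerModuleAt hy k n) :=
  letI := galoisCohomology.moduleH1 (S.T.ρ k) (S.T.hlin k)
  Ideal.span {S.π ^ S.stubLength hy hdec k n} • ⊤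

/-- Membership in the stub: `x ∈ Stub(n) ↔ x = π^{λ(n)} · y` for some Selmer class `y`.
[cite: Howard2004HeegnerKolyvagin, Def. 1.5.4 (arXiv p. 10, L58–60)] -/
theorem mem_stub_iff (S : DVRSetting p K R N Rk Nbar Nq) (hy : S.SatisfiesH) (hdec : S.HasLevelDecompositions hy)
    (k : ℕ) (n : Finset (HeightOneSpectrum (𝓞 K))) :
    letI := galoisCohomology.moduleH1 (S.T.ρ k) (S.T.hlin k)
    ∀ x : ↥(S.selmerModuleAt hy k n),
      x ∈ S.stub hy hdec k n ↔ ∃ y : ↥(S.selmerModuleAt hy k n), S.π ^ S.stubLength hy hdec k n • y = x := by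
  letI := galoisCohomology.moduleH1 (S.T.ρ k) (S.T.hlin k)
  intro x
  rw [stub, Submodule.ideal_span_singleton_smul, Submodule.mem_smul_pointwise_iff_exists]
  simp

/-! ## §3 (append, x10b-p1-w7 g9's «DEC-KEY») The weaker key `𝓝^{(j)} = 𝓝(𝓛 ∩ 𝓛_{e_j}(T))` -/

/-- **`𝓛^{(j)} = 𝓛 ∩ 𝓛_{e_j}(T)`** — Howard's level prime set, under which he applies Thm. 1.4.2 to `(T^{(j)}, F(n))`
(«`n ∈ 𝓝^{(j)}`», §1.6 ¶1); weaker than `enginePrimes j = 𝓛 ∩ 𝓛_{2e_j-1}`.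
[cite: Howard2004HeegnerKolyvagin, §1.6 (arXiv p. 11, L33–38)] -/
def levelPrimes (S : DVRSetting p K R N Rk Nbar Nq) (j : ℕ) : Set (HeightOneSpectrum (𝓞 K)) :=
  {v | v ∈ S.L ∧ v ∈ S.T.kolyvaginPrimes p (S.e j)}

/-- `𝓛^{(2k-1)} ⊆ 𝓛^{(j)}` whenever `e_j ≤ 2e_k - 1` (in particular `j = k`, every `i ≤ k`, and the level `j` with
`e_j = 2e_k - 1` used by the liftability case). [cite: Howard2004HeegnerKolyvagin, §1.6 and Lemma 1.6.4 (arXiv p. 11 L36–38, L85–90)] -/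
theorem enginePrimes_subset_levelPrimes_of_e_le (S : DVRSetting p K R N Rk Nbar Nq) {j k : ℕ}
    (h : S.e j ≤ 2 * S.e k - 1) : S.enginePrimes k ⊆ S.levelPrimes j := fun _ hv =>
  ⟨hv.1, S.T.kolyvaginPrimes_antitone p h hv.2⟩

/-- `𝓛^{(2k-1)} ⊆ 𝓛^{(k)}`. [cite: Howard2004HeegnerKolyvagin, §1.6 (arXiv p. 11, L36–38)] -/
theorem enginePrimes_subset_levelPrimes (S : DVRSetting p K R N Rk Nbar Nq) (hy : S.SatisfiesH) (k : ℕ) :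
    S.enginePrimes k ⊆ S.levelPrimes k :=
  S.enginePrimes_subset_levelPrimes_of_e_le (by
    have := hy.e_zero.trans_le (hy.e_strictMono.monotone (Nat.zero_le k)); omega)

/-- For `n ∈ 𝓝(𝓛^{(j)})` already `ker π_n = 0` on `T^{(j)}` (`I_n(T^{(j)}) = 0` in `R_j`).
[cite: Howard2004HeegnerKolyvagin, §1.6 (arXiv p. 11 L36–38: «T^{(k)}/I_n = T^{(k)} for n ∈ 𝓝^{(k)}»)] -/
theorem ker_π_eq_bot_of_subset_levelPrimes (S : DVRSetting p K R N Rk Nbar Nq) (hy : S.SatisfiesH) (j : ℕ)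
    {n : Finset (HeightOneSpectrum (𝓞 K))} (hn : ↑n ⊆ S.levelPrimes j) :
    LinearMap.ker ((S.LD j).π n) = ⊥ := by
  rw [((S.LD j).isQuotientBy n).ker_eq]
  have hI : levelIdeal (R := Rk j) (S.T.ρ j) n = ⊥ := by
    rw [levelIdeal, eq_bot_iff]
    refine iSup₂_le fun v hv => ?_
    rw [S.frobIdeal_eq_bot_of_mem_kolyvaginPrimes hy le_rfl (hn hv).2]
  rw [hI, Submodule.bot_smul]

/-- `n ∈ 𝓝(𝓛^{(j)}) ⇒ n ∈ 𝓝(𝓛)`. [cite: Howard2004HeegnerKolyvagin, §1.2 (arXiv p. 6, L98–100)] -/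
theorem mem_levelSet_of_subset_levelPrimes (S : DVRSetting p K R N Rk Nbar Nq) (hy : S.SatisfiesH) (j i : ℕ)
    {n : Finset (HeightOneSpectrum (𝓞 K))} (hn : ↑n ⊆ S.levelPrimes j) : n ∈ (S.t i).levelSet := by
  change ↑n ⊆ (S.t i).primes
  rw [hy.primes_eq]
  exact fun v hv => (hn hv).1

/-- **Thm. 1.4.2 as a hypothesis under Howard's own key `n ∈ 𝓝^{(j)}`** (the slot the typed fact fills; same
decomposition shape as `HasLevelDecompositions`, weaker key). [cite: Howard2004HeegnerKolyvagin, Thm. 1.4.2 applied to (T^{(j)}, F(n)), n ∈ 𝓝^{(j)} (arXiv Thm. 2.4.2, p. 8 L99–105; §1.6 p. 11 L33–44)] -/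
def HasLevelDecompositionsAt (S : DVRSetting p K R N Rk Nbar Nq) (hy : S.SatisfiesH) : Prop :=
  ∀ (j : ℕ) (n : Finset (HeightOneSpectrum (𝓞 K))), ↑n ⊆ S.levelPrimes j →
    ∃ (ε : ℕ) (_ : ε ≤ 1) (M : Type) (_ : AddCommGroup M) (_ : Module R M) (_ : Finite M)
      (θ : ↥((((S.t j).atLevel S.jbar n).cond).selmerGroup) ≃+
        ((Fin ε → R ⧸ IsLocalRing.maximalIdeal R ^ S.e j) × (M × M))),
      ∀ (r : R) (y : galoisCohomology (S.T.ρ j) 1) (hy' : y ∈ (((S.t j).atLevel S.jbar n).cond).selmerGroup),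
        θ ⟨galoisCohomology.scalarMapH1 (S.T.ρ j) (S.T.hlin j) r y,
            S.scalarMapH1_mem_selmerGroup_atLevel hy j n r hy'⟩ = r • θ ⟨y, hy'⟩

/-- The `𝓝^{(j)}`-keyed hypothesis implies the `𝓝(𝓛^{(2k-1)})`-keyed one (so `stubLength` / `stub` are fed by it).
[cite: Howard2004HeegnerKolyvagin, §1.6 (arXiv p. 11, L33–44)] -/
theorem HasLevelDecompositionsAt.toHasLevelDecompositions {S : DVRSetting p K R N Rk Nbar Nq} {hy : S.SatisfiesH}
    (h : S.HasLevelDecompositionsAt hy) : S.HasLevelDecompositions hy :=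
  fun k n hn => h k n (hn.trans (S.enginePrimes_subset_levelPrimes hy k))

end DVRSetting

end Literature.NumberTheory.GaloisCohomology.Howard2004

end
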